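import Summits.AnomalousDissipation.AnomalousDissipation.Theorems.SoloBlindDissipationFloorSlice

/-!
# Solo (blind) — the a-priori DISSIPATION floor along Leray–Hopf solutions is linear in `ν`,
# at every momentum

Companion of `SoloBlindEnergyFloorLH` (the Doering–Foias ENERGY floor). Testing the momentum
equation of a global Leray–Hopf weak solution of `NS_ν(f)` on `𝕋³` (`f` smooth, steady, zero
mean, FIXED) against a smooth divergence-free multiplier `Ψ` and Cesàro-averaging pins the
Reynolds-stress moment `⟨A⟩_T = ⟨∫ u⊗u : ∇Ψ⟩_T` to `-∫⟪f,Ψ⟫ + O(ν√E)`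
(`multiplier_window_eq`, `eventually_abs_stressBoundary_le`). Doering & Foias
(J. Fluid Mech. 467 (2002), §3) bound `|A|` in two ways; the second — moving the derivative onto
`u` — gives, for MEAN-ZERO flows, `|A| ≤ ‖Ψ‖_∞ ‖u‖₂‖∇u‖₂` and hence the lower bound
`ε ≥ ν F²ℓ²/(c U²)`: the dissipation of every statistically steady flow is at least LINEAR in `ν`.
The statement `Literature.Turb.ZerothLaw` (= `Summit.AnomalousDissipation`) leaves the momentum
`∫u` FREE (it is conserved but not pinned), and at non-zero momentum Poincaré's inequality fails;
this file proves the free-momentum version: split `u = m + u'` (`m = ∫u`), note that the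
`m ⊗ m` part of the stress integrates to zero against `∇Ψ`, that `|m|² ≤ ‖u‖₂²`, and that
`‖u'‖₂² ≤ ‖∇u‖₂²` (Poincaré WITH MEAN, tree lemma
`Literature.Analysis.FluidPDE.Torus.integral_norm_sq_le_add_toReal_eGradNormSq`), whence for every
`η > 0` and every `L²` slice with finite dissipation

  `∫ u⊗u : ∇Ψ ≥ -(M η ‖u‖₂² + (M/η) ‖∇u‖₂²)`,  `M = sup |∇Ψ|_F`   (`stressMoment_ge_dissipation_slice`),

and along every global Leray–Hopf solution with `meanEnergy u ≤ E` (`limsup`-Cesàro means of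
`ZerothLaw`), for every `η > 0`,

  `∫⟪f,Ψ⟫ ≤ M η E + (M/(η ν)) · meanDissipation ν u + ν ‖ΔΨ‖₂ √E`   (`forcePairing_le_dissipation_of_meanEnergy_le`),

so that (`η = Γ₀/(2ME)`, `Γ₀ = ∫⟪f,Ψ⟫ > 0`)

  `meanDissipation ν u ≥ ν Γ₀²/(4M²E) − ν² Γ₀ ‖ΔΨ‖₂ √E/(2M²E)`   (`meanDissipation_ge_linear`):

uniformly in the viscosity, with no hypothesis on data, momentum, uniqueness or regularity, the
mean dissipation of a bounded-energy Leray–Hopf family is AT LEAST of order `ν/E`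
(`meanDissipation_ge_linear_of_family`). The drifted Kolmogorov states of
`SoloBlindDriftScreening` (energy `≈ c² =: E`, dissipation `≤ ν/(2c²)`) show that the order `ν/E`
is attained: a-priori (energy–momentum–stress budget) methods give exactly the rate `ν¹` for the
zeroth law, from below as well as from above.
[cite: DoeringFoias2002, §3] [cite: FoiasManleyRosaTemam2001, Ch. IV §3.1 (3.2), (3.4)]
-/

open MeasureTheory Filter Topology Set UnitAddTorus
open scoped ENNReal NNReal InnerProductSpace

noncomputable section

namespace Summit.AnomalousDissipation.AnomalousDissipation.Theorems

open Literature.Analysis.FunctionSpaces Literature.Analysis.FunctionSpaces.Torus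
open Literature.Analysis.FluidPDE

variable {ν η M T : ℝ} {f Ψ u₀ : UnitAddTorus (Fin 3) → EuclideanSpace ℝ (Fin 3)}
  {u : ℝ → UnitAddTorus (Fin 3) → EuclideanSpace ℝ (Fin 3)}

/-! ### Cesàro means along a global Leray–Hopf solution -/

/-- The Cesàro means `⟨ν‖∇u‖₂²⟩_T` of the dissipation (`meanDissipation ν u` is their `limsup`).
[folklore] -/
def dissipationMean (ν : ℝ) (u : ℝ → UnitAddTorus (Fin 3) → EuclideanSpace ℝ (Fin 3)) : ℝ → ℝ :=
  timeMean fun s => ν * (Torus.eGradNormSq (u s)).toReal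

/-- **`⟨A⟩_T ≥ -(Mη ⟨‖u‖²⟩_T + (M/(ην)) ⟨ν‖∇u‖²⟩_T)`** along a global Leray–Hopf solution
(`T > 0`, `ν > 0`, `η > 0`): the slice inequality holds at a.e. time (finite dissipation a.e.)
and is integrated. [folklore] -/
theorem stressMean_ge_dissipation (hu : Torus.IsGlobalLerayHopf ν (fun _ => f) u₀ u) (hν : 0 < ν)
    (hf : IsSmooth f) (hΨ : IsSmooth Ψ)
    (hM : ∀ x, Real.sqrt (∑ i, ‖Torus.partialDeriv i Ψ x‖ ^ 2) ≤ M) (hη : 0 < η) (hT : 0 < T) :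
    -(M * η * energyMean u T + M / η * ν⁻¹ * dissipationMean ν u T) ≤ stressMean Ψ u T := by
  have hLH := hu T hT
  have hmeas := hLH.aemeasurable_eGradNormSq
  have hfin := hLH.lintegral_eGradNormSq_lt_top
  have hlt : ∀ᵐ s ∂(volume.restrict (Ioo 0 T)), Torus.eGradNormSq (u s) < ⊤ :=
    ae_lt_top' hmeas hfin.ne
  have hGint : IntegrableOn (fun s => (Torus.eGradNormSq (u s)).toReal) (Ioc 0 T) :=
    (integrableOn_Ioc_iff_integrableOn_Ioo).mpr (integrable_toReal_of_lintegral_ne_top hmeas hfin.ne)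
  have hlt' : ∀ᵐ s ∂(volume.restrict (Ioc 0 T)), Torus.eGradNormSq (u s) < ⊤ := by
    rw [← Measure.restrict_congr_set (Ioo_ae_eq_Ioc (μ := volume) (a := (0 : ℝ)) (b := T))]
    exact hlt
  have hA := (integrableOn_Ioc_iff_integrableOn_Ioo).mpr (lh_integrableOn_stressMoment' hLH hf hΨ)
  have hE : IntegrableOn (fun τ => ∫ x, ‖u τ x‖ ^ 2) (Ioc 0 T) :=
    hu.integrableOn_integral_norm_sq hT
  have hL : IntegrableOn (fun s => -(M * η * (∫ x, ‖u s x‖ ^ 2) +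
      M / η * (Torus.eGradNormSq (u s)).toReal)) (Ioc 0 T) :=
    ((hE.const_mul _).add (hGint.const_mul _)).neg
  have hmono : ∫ s in Ioc 0 T, -(M * η * (∫ x, ‖u s x‖ ^ 2) +
      M / η * (Torus.eGradNormSq (u s)).toReal) ≤ ∫ s in Ioc 0 T, stressMoment Ψ u s := by
    refine setIntegral_mono_ae_restrict hL hA ?_
    filter_upwards [hlt', ae_restrict_mem measurableSet_Ioc] with s hs1 hs2
    exact stressMoment_ge_dissipation_slice (hLH.memLp s ⟨hs2.1.le, hs2.2⟩) hs1.ne hΨ hM hη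
  have hsplit : ∫ s in Ioc 0 T, -(M * η * (∫ x, ‖u s x‖ ^ 2) +
      M / η * (Torus.eGradNormSq (u s)).toReal) =
      -(M * η * (∫ s in Ioc 0 T, ∫ x, ‖u s x‖ ^ 2) +
        M / η * ∫ s in Ioc 0 T, (Torus.eGradNormSq (u s)).toReal) := by
    rw [integral_neg, integral_add (hE.const_mul _) (hGint.const_mul _), integral_const_mul,
      integral_const_mul]
  rw [hsplit] at hmono
  unfold stressMean energyMean dissipationMean timeMean
  rw [intervalIntegral.integral_of_le hT.le, intervalIntegral.integral_of_le hT.le,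
    intervalIntegral.integral_of_le hT.le, integral_const_mul]
  have hTi : 0 ≤ T⁻¹ := inv_nonneg.2 hT.le
  have key := mul_le_mul_of_nonneg_left hmono hTi
  have hνid : M / η * ν⁻¹ * (T⁻¹ * (ν * ∫ s in Ioc 0 T, (Torus.eGradNormSq (u s)).toReal)) =
      T⁻¹ * (M / η * ∫ s in Ioc 0 T, (Torus.eGradNormSq (u s)).toReal) := by
    field_simp
  rw [hνid]
  linarith

/-- **The dissipation-side amplitude inequality, Cesàro form**: for every `δ > 0`, eventually in
`T`, `∫⟪f,Ψ⟫ ≤ Mη ⟨‖u‖²⟩_T + (M/(ην)) ⟨ν‖∇u‖²⟩_T + ν‖ΔΨ‖₂ √⟨‖u‖²⟩_T + δ` (`ν, η > 0`,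
`|∇Ψ| ≤ M`, `Ψ` divergence-free). [cite: DoeringFoias2002, §3] -/
theorem forcePairing_le_dissipation_eventually (hu : Torus.IsGlobalLerayHopf ν (fun _ => f) u₀ u)
    (hν : 0 < ν) (hf : IsSmooth f) (hf0 : HasZeroMean f) (hΨ : IsSmooth Ψ) (hΨdiv : IsDivFree Ψ)
    (hM : ∀ x, Real.sqrt (∑ i, ‖Torus.partialDeriv i Ψ x‖ ^ 2) ≤ M) (hη : 0 < η)
    {δ : ℝ} (hδ : 0 < δ) :
    ∀ᶠ T : ℝ in atTop, ∫ x, ⟪f x, Ψ x⟫_ℝ ≤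
      M * η * energyMean u T + M / η * ν⁻¹ * dissipationMean ν u T +
        ν * Real.sqrt (∫ x, ‖Torus.laplacian Ψ x‖ ^ 2) * Real.sqrt (energyMean u T) + δ := by
  filter_upwards [eventually_abs_stressBoundary_le hu hν hf hf0 hΨ hδ,
    eventually_gt_atTop (0 : ℝ)] with T hb hT
  have e := multiplier_window_eq hu hf hΨ hΨdiv hT
  have hA := stressMean_ge_dissipation hu hν hf hΨ hM hη hT
  obtain ⟨v1, -⟩ := abs_le.1 (abs_laplacePairingMean_le hu hΨ hT)
  obtain ⟨-, b2⟩ := abs_le.1 hb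
  have q := mul_le_mul_of_nonneg_left v1 hν.le
  linarith

/-- **The dissipation-side amplitude inequality.** Along every global Leray–Hopf weak solution of
`NS_ν(f)` on `𝕋³` (`ν > 0`, `f` smooth with zero mean), for every smooth divergence-free `Ψ`
with `|∇Ψ| ≤ M`, every `η > 0` and every `E ≥ meanEnergy u`:
`∫⟪f,Ψ⟫ ≤ M η E + (M/(ην)) · meanDissipation ν u + ν ‖ΔΨ‖₂ √E`. [cite: DoeringFoias2002, §3] -/
theorem forcePairing_le_dissipation_of_meanEnergy_le
    (hu : Torus.IsGlobalLerayHopf ν (fun _ => f) u₀ u)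
    (hν : 0 < ν) (hf : IsSmooth f) (hf0 : HasZeroMean f) (hΨ : IsSmooth Ψ) (hΨdiv : IsDivFree Ψ)
    (hM : ∀ x, Real.sqrt (∑ i, ‖Torus.partialDeriv i Ψ x‖ ^ 2) ≤ M) (hη : 0 < η)
    {E : ℝ} (hE : meanEnergy u ≤ E) :
    ∫ x, ⟪f x, Ψ x⟫_ℝ ≤ M * η * E + M / η * ν⁻¹ * meanDissipation ν u +
      ν * Real.sqrt (∫ x, ‖Torus.laplacian Ψ x‖ ^ 2) * Real.sqrt E := by
  change limsup (energyMean u) atTop ≤ E at hE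
  have hM0 : 0 ≤ M := (Real.sqrt_nonneg _).trans (hM 0)
  set L : ℝ := ν * Real.sqrt (∫ x, ‖Torus.laplacian Ψ x‖ ^ 2) with hL
  have hL0 : 0 ≤ L := by positivity
  set D : ℝ := meanDissipation ν u with hDdef
  have hDlim : D = limsup (dissipationMean ν u) atTop := rfl
  obtain ⟨K, hK0, hK⟩ := exists_energyMean_le_general hu hν hf hf0
  have hbddE : IsBoundedUnder (· ≤ ·) atTop (energyMean u) :=
    isBoundedUnder_of_eventually_le ((eventually_ge_atTop (1 : ℝ)).mono hK)
  have hbddD : IsBoundedUnder (· ≤ ·) atTop (dissipationMean ν u) :=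
    hu.isBoundedUnder_timeMean_dissipation hν (hf.memLp 2) hf0
  have hE0 : 0 ≤ E := by
    refine le_trans (le_limsup_of_frequently_le (Eventually.frequently ?_) hbddE) hE
    filter_upwards [eventually_ge_atTop (0 : ℝ)] with T hT
    exact mul_nonneg (inv_nonneg.2 hT) (intervalIntegral.integral_nonneg hT fun t _ =>
      integral_nonneg fun _ => by positivity)
  set s : ℝ := Real.sqrt E with hs
  have hs0 : 0 ≤ s := Real.sqrt_nonneg _
  have hsE : s ^ 2 = E := Real.sq_sqrt hE0
  have hc0 : 0 ≤ M * η := by positivity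
  have hq0 : 0 ≤ M / η * ν⁻¹ := by positivity
  refine le_of_forall_pos_le_add fun ε hε => ?_
  -- `η'` for the energy overshoot, `ε''` for the dissipation overshoot
  set D' : ℝ := M * η * (2 * s + 1) + L with hD'
  have hD'0 : 0 ≤ D' := by positivity
  obtain ⟨η', hη'0, hη'1, hη'D⟩ : ∃ η' : ℝ, 0 < η' ∧ η' ≤ 1 ∧ D' * η' ≤ ε / 4 := by
    refine ⟨min 1 (ε / 4 / (D' + 1)), by positivity, min_le_left _ _, ?_⟩
    calc D' * min 1 (ε / 4 / (D' + 1)) ≤ (D' + 1) * (ε / 4 / (D' + 1)) :=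
          mul_le_mul (by linarith) (min_le_right _ _) (by positivity) (by positivity)
      _ = ε / 4 := mul_div_cancel₀ _ (by positivity)
  set ε'' : ℝ := ε / 4 / (M / η * ν⁻¹ + 1) with hε''
  have hε''0 : 0 < ε'' := by positivity
  have hε''b : M / η * ν⁻¹ * ε'' ≤ ε / 4 := by
    rw [hε'']
    rw [mul_div_assoc']
    rw [div_le_iff₀ (by positivity)]
    nlinarith
  have hev := forcePairing_le_dissipation_eventually hu hν hf hf0 hΨ hΨdiv hM hη
    (by positivity : (0 : ℝ) < ε / 2)
  have hsq := eventually_le_sq_sqrt_add hE0 hη'0 hbddE hE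
  have hDev : ∀ᶠ T in atTop, dissipationMean ν u T < D + ε'' := by
    rw [hDlim]
    exact eventually_lt_of_limsup_lt (by linarith) hbddD
  obtain ⟨T, h1, h2, h3⟩ := (hev.and (hsq.and hDev)).exists
  have hsqrtT : Real.sqrt (energyMean u T) ≤ s + η' :=
    calc Real.sqrt (energyMean u T) ≤ Real.sqrt ((s + η') ^ 2) := Real.sqrt_le_sqrt h2
      _ = s + η' := Real.sqrt_sq (by positivity)
  have i1 : M * η * energyMean u T ≤ M * η * (s + η') ^ 2 := mul_le_mul_of_nonneg_left h2 hc0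
  have i2 : L * Real.sqrt (energyMean u T) ≤ L * (s + η') := mul_le_mul_of_nonneg_left hsqrtT hL0
  have i3 : M * η * (s + η') ^ 2 + L * (s + η') ≤ M * η * E + L * s + D' * η' := by
    rw [← hsE, hD']
    nlinarith [mul_nonneg hc0 (mul_nonneg hη'0.le (sub_nonneg.2 hη'1))]
  have i4 : M / η * ν⁻¹ * dissipationMean ν u T ≤ M / η * ν⁻¹ * D + M / η * ν⁻¹ * ε'' := by
    have := mul_le_mul_of_nonneg_left h3.le hq0
    linarith
  have h1' : ∫ x, ⟪f x, Ψ x⟫_ℝ ≤ M * η * energyMean u T + M / η * ν⁻¹ * dissipationMean ν u T +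
      L * Real.sqrt (energyMean u T) + ε / 2 := by
    rw [hL]; linarith
  calc ∫ x, ⟪f x, Ψ x⟫_ℝ
      ≤ M * η * energyMean u T + M / η * ν⁻¹ * dissipationMean ν u T +
          L * Real.sqrt (energyMean u T) + ε / 2 := h1'
    _ ≤ M * η * E + M / η * ν⁻¹ * D + L * s + D' * η' + M / η * ν⁻¹ * ε'' + ε / 2 := by linarith
    _ ≤ M * η * E + M / η * ν⁻¹ * D + L * s + ε := by linarith

/-! ### The floor, linear in `ν` -/

/-- **The a-priori dissipation floor, linear in the viscosity, at every momentum.** Along every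
global Leray–Hopf weak solution of `NS_ν(f)` on `𝕋³` (`ν > 0`, `f` smooth with zero mean,
arbitrary data and momentum), for every smooth divergence-free `Ψ` with `|∇Ψ| ≤ M` (`M > 0`),
`Γ₀ := ∫⟪f,Ψ⟫ > 0` and every `E ≥ meanEnergy u`, `E > 0`:
`meanDissipation ν u ≥ ν Γ₀²/(4M²E) − ν² Γ₀ ‖ΔΨ‖₂ √E/(2M²E)`.
With `Ψ = f`: `Γ₀ = ‖f‖₂²`. [cite: DoeringFoias2002, §3] -/
theorem meanDissipation_ge_linear (hu : Torus.IsGlobalLerayHopf ν (fun _ => f) u₀ u)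
    (hν : 0 < ν) (hf : IsSmooth f) (hf0 : HasZeroMean f) (hΨ : IsSmooth Ψ) (hΨdiv : IsDivFree Ψ)
    (hM : ∀ x, Real.sqrt (∑ i, ‖Torus.partialDeriv i Ψ x‖ ^ 2) ≤ M) (hMpos : 0 < M)
    (hΓ : 0 < ∫ x, ⟪f x, Ψ x⟫_ℝ) {E : ℝ} (hE : meanEnergy u ≤ E) (hEpos : 0 < E) :
    ν * (∫ x, ⟪f x, Ψ x⟫_ℝ) ^ 2 / (4 * M ^ 2 * E) -
        ν ^ 2 * (∫ x, ⟪f x, Ψ x⟫_ℝ) * Real.sqrt (∫ x, ‖Torus.laplacian Ψ x‖ ^ 2) *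
          Real.sqrt E / (2 * M ^ 2 * E) ≤ meanDissipation ν u := by
  set Γ₀ : ℝ := ∫ x, ⟪f x, Ψ x⟫_ℝ with hΓ₀
  set K : ℝ := Real.sqrt (∫ x, ‖Torus.laplacian Ψ x‖ ^ 2) with hK
  set D : ℝ := meanDissipation ν u with hD
  have hη : 0 < Γ₀ / (2 * M * E) := by positivity
  have hB := forcePairing_le_dissipation_of_meanEnergy_le hu hν hf hf0 hΨ hΨdiv hM hη hE
  have h1 : M * (Γ₀ / (2 * M * E)) * E = Γ₀ / 2 := by
    field_simp
  have h2 : M / (Γ₀ / (2 * M * E)) * ν⁻¹ = 2 * M ^ 2 * E / (Γ₀ * ν) := by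
    field_simp
  rw [h1, h2] at hB
  have h3 : Γ₀ / 2 - ν * K * Real.sqrt E ≤ 2 * M ^ 2 * E / (Γ₀ * ν) * D := by
    rw [hK]; linarith
  have hpos : 0 < Γ₀ * ν / (2 * M ^ 2 * E) := by positivity
  have h4 := mul_le_mul_of_nonneg_right h3 hpos.le
  have h5 : 2 * M ^ 2 * E / (Γ₀ * ν) * D * (Γ₀ * ν / (2 * M ^ 2 * E)) = D := by
    field_simp
  rw [h5] at h4
  calc ν * Γ₀ ^ 2 / (4 * M ^ 2 * E) - ν ^ 2 * Γ₀ * K * Real.sqrt E / (2 * M ^ 2 * E)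
      = (Γ₀ / 2 - ν * K * Real.sqrt E) * (Γ₀ * ν / (2 * M ^ 2 * E)) := by
        field_simp
        ring
    _ ≤ D := h4

/-- **Vanishing-viscosity families: the dissipation is at least linear in `νⱼ`.** Along any
family of global Leray–Hopf weak solutions `uⱼ` of `NS_{νⱼ}(f)` (`νⱼ > 0`, ONE fixed smooth
mean-zero `f`, arbitrary data and momenta) with `meanEnergy (u j) ≤ E`:
`meanDissipation νⱼ uⱼ ≥ νⱼ Γ₀²/(4M²E) − νⱼ² Γ₀‖ΔΨ‖₂√E/(2M²E)` for every `j` — the rate `ν¹`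
that the drifted Kolmogorov competitors (`SoloBlindDriftScreening`: energy `≈ c²`, dissipation
`≤ ν/(2c²)`) show to be optimal among a-priori bounds. [cite: DoeringFoias2002, §3] -/
theorem meanDissipation_ge_linear_of_family {ν : ℕ → ℝ}
    {u₀ : ℕ → UnitAddTorus (Fin 3) → EuclideanSpace ℝ (Fin 3)}
    {u : ℕ → ℝ → UnitAddTorus (Fin 3) → EuclideanSpace ℝ (Fin 3)} {E : ℝ}
    (hν : ∀ j, 0 < ν j)
    (hu : ∀ j, Torus.IsGlobalLerayHopf (ν j) (fun _ => f) (u₀ j) (u j))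
    (hf : IsSmooth f) (hf0 : HasZeroMean f) (hΨ : IsSmooth Ψ) (hΨdiv : IsDivFree Ψ)
    (hM : ∀ x, Real.sqrt (∑ i, ‖Torus.partialDeriv i Ψ x‖ ^ 2) ≤ M) (hMpos : 0 < M)
    (hΓ : 0 < ∫ x, ⟪f x, Ψ x⟫_ℝ) (hE : ∀ j, meanEnergy (u j) ≤ E) (hEpos : 0 < E) (j : ℕ) :
    ν j * (∫ x, ⟪f x, Ψ x⟫_ℝ) ^ 2 / (4 * M ^ 2 * E) -
        ν j ^ 2 * (∫ x, ⟪f x, Ψ x⟫_ℝ) * Real.sqrt (∫ x, ‖Torus.laplacian Ψ x‖ ^ 2) *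
          Real.sqrt E / (2 * M ^ 2 * E) ≤ meanDissipation (ν j) (u j) :=
  meanDissipation_ge_linear (hu j) (hν j) hf hf0 hΨ hΨdiv hM hMpos hΓ (hE j) hEpos

/-- **Eventual clean form**: along such a family with `νⱼ → 0`, eventually in `j`
`meanDissipation νⱼ uⱼ ≥ νⱼ · Γ₀²/(8M²E)`. [cite: DoeringFoias2002, §3] -/
theorem meanDissipation_ge_linear_eventually {ν : ℕ → ℝ}
    {u₀ : ℕ → UnitAddTorus (Fin 3) → EuclideanSpace ℝ (Fin 3)}
    {u : ℕ → ℝ → UnitAddTorus (Fin 3) → EuclideanSpace ℝ (Fin 3)} {E : ℝ}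
    (hν : ∀ j, 0 < ν j) (hν₀ : Tendsto ν atTop (𝓝 0))
    (hu : ∀ j, Torus.IsGlobalLerayHopf (ν j) (fun _ => f) (u₀ j) (u j))
    (hf : IsSmooth f) (hf0 : HasZeroMean f) (hΨ : IsSmooth Ψ) (hΨdiv : IsDivFree Ψ)
    (hM : ∀ x, Real.sqrt (∑ i, ‖Torus.partialDeriv i Ψ x‖ ^ 2) ≤ M) (hMpos : 0 < M)
    (hΓ : 0 < ∫ x, ⟪f x, Ψ x⟫_ℝ) (hE : ∀ j, meanEnergy (u j) ≤ E) (hEpos : 0 < E) :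
    ∀ᶠ j in atTop,
      ν j * ((∫ x, ⟪f x, Ψ x⟫_ℝ) ^ 2 / (8 * M ^ 2 * E)) ≤ meanDissipation (ν j) (u j) := by
  set Γ₀ : ℝ := ∫ x, ⟪f x, Ψ x⟫_ℝ with hΓ₀
  set K : ℝ := Real.sqrt (∫ x, ‖Torus.laplacian Ψ x‖ ^ 2) with hK
  have hK0 : 0 ≤ K := Real.sqrt_nonneg _
  have hsE : 0 < Real.sqrt E := Real.sqrt_pos.2 hEpos
  -- threshold `ν ≤ c` with `c = Γ₀ / (4 (K + 1) √E)`
  set c : ℝ := Γ₀ / (4 * (K + 1) * Real.sqrt E) with hc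
  have hcpos : 0 < c := by positivity
  filter_upwards [hν₀.eventually (ge_mem_nhds hcpos)] with j hj
  have hmain := meanDissipation_ge_linear (hu j) (hν j) hf hf0 hΨ hΨdiv hM hMpos hΓ (hE j) hEpos
  have hνj := hν j
  -- `ν² Γ₀ K √E/(2M²E) ≤ ν Γ₀²/(8M²E)` when `ν ≤ c`
  have hKc : ν j * K * Real.sqrt E ≤ Γ₀ / 4 := by
    have h1 : ν j * K * Real.sqrt E ≤ c * K * Real.sqrt E := by gcongr
    have h2 : c * K * Real.sqrt E ≤ Γ₀ / 4 := by
      rw [hc]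
      rw [div_mul_eq_mul_div, div_mul_eq_mul_div, div_le_div_iff₀ (by positivity) (by positivity)]
      nlinarith [mul_nonneg hΓ.le hsE.le, mul_nonneg (mul_nonneg hΓ.le hK0) hsE.le]
    exact h1.trans h2
  have hcorr : ν j ^ 2 * Γ₀ * K * Real.sqrt E / (2 * M ^ 2 * E) ≤
      ν j * Γ₀ ^ 2 / (8 * M ^ 2 * E) := by
    rw [div_le_div_iff₀ (by positivity) (by positivity)]
    have hME : 0 < M ^ 2 * E := by positivity
    nlinarith [mul_le_mul_of_nonneg_left hKc (by positivity : (0 : ℝ) ≤ ν j * Γ₀ * (M ^ 2 * E))]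
  have hsplit : ν j * (Γ₀ ^ 2 / (8 * M ^ 2 * E)) =
      ν j * Γ₀ ^ 2 / (4 * M ^ 2 * E) - ν j * Γ₀ ^ 2 / (8 * M ^ 2 * E) := by
    field_simp
    ring
  rw [hsplit]
  linarith

end Summit.AnomalousDissipation.AnomalousDissipation.Theorems
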